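import Summits.ABC.IUTFork.Cor312GenuineKLocalType
import Literature.IUT.LogVolume.GenuineTowerLocalTypeThirty
import HarnessLib

/-!
# [IUTchIII] Cor. 3.12, branch C / R-W window table — the SHARP local type at the `K`-level pilot datum:
# `e(K_{x₀}/ℚ_p) ∣ 30·l` at every fibre point over a rational pole of `j` away from `2·3·5·l` (cyclic tame inertia)

PROOF-ONLY support file (D-0012; 0 definitions, 0 `Prop` facts) of the abc-iut cell (R-W «WINDOW Θ-SIDE INEQUALITY», seat
abc-iut-W-neg-1 gen 0). TAKES NO SIDE on [IUTchIII] Cor. 3.12 (S. Mochizuki, *Inter-universal Teichmüller theory III*, RIMS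
manuscript, Cor. 3.12 p. 173–174) or on any author: classical algebraic number theory on the cell's typed Θ-volume data.

Twin of this seat's `Cor312GenuineKLocalType.lean` (`e ∣ 60·l`) with the cyclic-inertia sharpening `e(w | v₀) ∣ 30`
(`Cor22.ramificationIdx_subThetaField_dvd_thirty`: the image of absolute inertia in `Gal(F/F_tpd)` is tame, hence cyclic —
Serre, *Local Fields* IV §2 Cor. 1 — generated by one `s` with `s^{30}` fixing `F`):

* `Conditional.GenuineK.absRamificationIdx_kOf_dvd_thirty_mul_ratPoint` — for a genuine Θ-volume datum `T` at a RATIONAL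
  point `(ratPoint q, l)`, a prime `p ∉ {2, 3, 5, l}` at which `j(q)` has a pole, and EVERY fibre point `x₀ | p` of the index
  of `pilotDataOfK T.D T.K`: `e(K_{x₀}/ℚ_p) ∣ 30·l` and `¬ p ∣ e(K_{x₀}/ℚ_p)`;
* **`Conditional.GenuineK.localType_lamSeven_thirty`** — at `λ_k = 1/2 + 2/7^k` (`k ≥ 1`), `l ≥ 11`, `p = 7`: for EVERY
  genuine Θ-volume datum `T` at `(ratPoint λ_k, l)` and EVERY `x₀ | 7`: **`¬ 7 ∣ e(K_{x₀}/ℚ_7) ∧ e(K_{x₀}/ℚ_7) ∣ 30·l`**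
  (numerically exact up to the factor `gcd`: `e ∈ {e_x·l, 2e_x·l}`, `e_x = 15/gcd(15, k)`, abc-iut rw-num-lead N1b);
* `Conditional.GenuineK.absRamificationIdx_kOf_le_thirty_mul_lamSeven` — hence `e(K_{x₀}/ℚ_7) ≤ 30·l` (the shape `hloc : ∀ x₀,
  e ≤ E` of abc-iut-W-neg-2's general-`E` engine `GenuineK.not_pilotKummerCompatHull_lamSeven_of_ramification_le`, `E := 30·l`).

HONEST FRAMING: bookkeeping over OUR typed objects; nothing here bears on the printed inequality of [IUTchIII] Cor. 3.12 or on the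
number-level `Cor22.Cor312AtDatum`; typed ≠ proved; instantiated ≠ endorsed.
[cite: Mochizuki2012, IUTchI Ex. 3.2 (iv) p. 71; IUTchIV Thm. 1.10 Steps (ii)–(iii) p. 24–26, Cor. 2.2 (ii) proof (P5) p. 46]
[cite: SerreLocalFields1979, Ch. IV §2 Cor. 1 of Prop. 7] [cite: Serre1972, §1.11–§1.12] [claim: Mochizuki2012, status: disputed] for every IUT quotation.
-/

noncomputable section

open NumberField IsDedekindDomain

namespace Summit.ABC.IUTFork.Conditional

open Thm311 Thm311.Real Cor312 Cor312Prov Literature.IUT.LogVolume Literature.IUT.HodgeTheaters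
  Literature.IUT.LogThetaLattice Literature.NumberTheory.NumberFields Literature.NumberTheory.DiophantineGeometry.GenEll
  Literature.NumberTheory.DiophantineGeometry

/-- **The sharp local type at a fibre point over a rational pole of `j`, away from `2·3·5·l`.** For a genuine Θ-volume
datum `T` at `(ratPoint q, l)`, a prime `p ∉ {2, 3, 5, l}` with `ord_v j(q) < 0` at the place `v` of `ℚ` over `p`, and EVERY
point `x₀` of the fibre over `p` of the index of `pilotDataOfK T.D T.K`: `e(K_{x₀}/ℚ_p) ∣ 30·l` and `p ∤ e(K_{x₀}/ℚ_p)`.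
[cite: Mochizuki2012, IUTchIV Thm. 1.10 proof Steps (ii)–(iii) p. 24–26] [cite: SerreLocalFields1979, Ch. IV §2 Cor. 1 of Prop. 7]
[claim: Mochizuki2012, status: disputed] -/
theorem GenuineK.absRamificationIdx_kOf_dvd_thirty_mul_ratPoint {q : ℚ} {l : ℕ}
    (T : Cor22.ThetaVolumeDatumAt (ratPoint q) l)
    (pp : Nat.Primes) (hp2 : (pp : ℕ) ≠ 2) (hp3 : (pp : ℕ) ≠ 3) (hp5 : (pp : ℕ) ≠ 5) (hpl : (pp : ℕ) ≠ l)
    (hpole : ∀ v : HeightOneSpectrum (𝓞 ℚ), Rat.HeightOneSpectrum.natGenerator v = pp →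
      Literature.IUT.LogVolume.ord ℚ v (Cor22.jInv q) < 0) :
    letI := T.instFieldF; letI := T.instNumberFieldF; letI := T.instAlgebraF; letI := T.instFieldK
    letI := T.instNumberFieldK; letI := T.instAlgebraK; letI := T.instFieldFbar; letI := T.instAlgebraFbar
    letI := T.instAlgebraKFbar; letI := T.instIsElliptic
    haveI : Fact (pp : ℕ).Prime := ⟨pp.2⟩
    ∀ x₀ : (thetaIndex (pilotDataOfK T.D T.K)).Fibre (.inr pp),
      absRamificationIdx (pp : ℕ) (kOf (pilotDataOfK T.D T.K) pp.1 x₀) ∣ 30 * l ∧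
      ¬ (pp : ℕ) ∣ absRamificationIdx (pp : ℕ) (kOf (pilotDataOfK T.D T.K) pp.1 x₀) := by
  letI := T.instFieldF; letI := T.instNumberFieldF; letI := T.instAlgebraF; letI := T.instFieldK
  letI := T.instNumberFieldK; letI := T.instAlgebraK; letI := T.instFieldFbar; letI := T.instAlgebraFbar
  letI := T.instAlgebraKFbar; letI := T.instIsElliptic
  haveI : Fact (pp : ℕ).Prime := ⟨pp.2⟩
  set X := pilotDataOfK T.D T.K with hXdef
  intro x₀
  set w := placeOf X pp.1 x₀ with hwdef
  have hpw : ((pp : ℕ) : 𝓞 T.K) ∈ w.asIdeal := natCast_mem_placeOf X pp.1 x₀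
  have hwchar : residueChar T.K w = (pp : ℕ) := residueChar_eq_of_natCast_mem pp.1 hpw
  have hekOf : absRamificationIdx (pp : ℕ) (kOf X pp.1 x₀) = w.asIdeal.ramificationIdx ℤ := by
    rw [show absRamificationIdx (pp : ℕ) (kOf X pp.1 x₀) =
        absRamificationIdx (pp : ℕ) (RescaledCompletion T.K pp.1 (placeOf X pp.1 x₀) hpw) from rfl,
      absRamificationIdx_rescaledCompletion]
  have hnot : (pp : ℕ) ∉ ({2, 3, 5, l} : Finset ℕ) := by
    simp only [Finset.mem_insert, Finset.mem_singleton, not_or]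
    exact ⟨hp2, hp3, hp5, hpl⟩
  have hdvd : w.asIdeal.ramificationIdx ℤ ∣ 30 * l :=
    T.ramificationIdx_int_dvd_thirty_mul_ratPoint' hnot hpole w hwchar
  rw [hekOf]
  refine ⟨hdvd, fun h => ?_⟩
  -- `p ∤ 30·l` for a prime `p ∉ {2, 3, 5, l}` (via the coarser `∣ 60·l` twin's argument on `30·l ∣ 60·l`)
  have h60 := (GenuineK.absRamificationIdx_kOf_dvd_ratPoint T pp hp2 hp3 hp5 hpl hpole x₀).2
  rw [hekOf] at h60
  exact h60 h

/-- **THE SHARP LOCAL-TYPE LEMMA at `λ_k`.** For `k ≥ 1`, `l ≥ 11` (`l` prime from the datum) and EVERY genuine Θ-volume datum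
`T` at `(ratPoint λ_k, l)`, `λ_k = 1/2 + 2/7^k`, and EVERY fibre point `x₀ | 7` of the index of `pilotDataOfK T.D T.K`:
**`¬ 7 ∣ e(K_{x₀}/ℚ_7)` and `e(K_{x₀}/ℚ_7) ∣ 30·l`** (tame inertia is cyclic; `e(x₀|v) ∣ l`, `e(v|7) ∣ 30 = 2·15`).
[cite: Mochizuki2012, IUTchI Ex. 3.2 (iv) p. 71; IUTchIV Cor. 2.2 (ii) proof (P5) p. 46] [cite: SerreLocalFields1979, Ch. IV §2 Cor. 1 of Prop. 7]
[claim: Mochizuki2012, status: disputed] -/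
theorem GenuineK.localType_lamSeven_thirty {k l : ℕ} (hk : 1 ≤ k) (h11 : 11 ≤ l)
    (T : Cor22.ThetaVolumeDatumAt (ratPoint ((2 : ℚ)⁻¹ + 2 / 7 ^ k)) l) :
    letI := T.instFieldF; letI := T.instNumberFieldF; letI := T.instAlgebraF; letI := T.instFieldK
    letI := T.instNumberFieldK; letI := T.instAlgebraK; letI := T.instFieldFbar; letI := T.instAlgebraFbar
    letI := T.instAlgebraKFbar; letI := T.instIsElliptic
    haveI : Fact (Nat.Prime 7) := ⟨by norm_num⟩
    ∀ x₀ : (thetaIndex (pilotDataOfK T.D T.K)).Fibre (.inr ⟨7, by norm_num⟩),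
      ¬ 7 ∣ absRamificationIdx 7 (kOf (pilotDataOfK T.D T.K) 7 x₀) ∧
      absRamificationIdx 7 (kOf (pilotDataOfK T.D T.K) 7 x₀) ∣ 30 * l := by
  intro x₀
  have h := GenuineK.absRamificationIdx_kOf_dvd_thirty_mul_ratPoint T ⟨7, by norm_num⟩ (by norm_num) (by norm_num)
    (by norm_num) (show (7 : ℕ) ≠ l by omega) (fun v hv => Cor22.ord_jInv_lamSeven_neg v hv hk) x₀
  exact ⟨h.2, h.1⟩

/-- **Corollary: `e(K_{x₀}/ℚ_7) ≤ 30·l`** at every fibre point `x₀ | 7` of a genuine Θ-volume datum at `(ratPoint λ_k, l)`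
(`k ≥ 1`, `l ≥ 11`) — the hypothesis shape `∀ x₀, e ≤ E` of the general-`E` explicit-depth engine with `E := 30·l`; caps the
[IUTchIV] Prop. 1.2 constant `b = ⌊log₇(7e/6)⌋ − 1/e` by `⌊log₇(35·l)⌋ − 1/e`.
[cite: Mochizuki2012, IUTchIV Prop. 1.2 p. 10] [claim: Mochizuki2012, status: disputed] -/
theorem GenuineK.absRamificationIdx_kOf_le_thirty_mul_lamSeven {k l : ℕ} (hk : 1 ≤ k) (h11 : 11 ≤ l)
    (T : Cor22.ThetaVolumeDatumAt (ratPoint ((2 : ℚ)⁻¹ + 2 / 7 ^ k)) l) :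
    letI := T.instFieldF; letI := T.instNumberFieldF; letI := T.instAlgebraF; letI := T.instFieldK
    letI := T.instNumberFieldK; letI := T.instAlgebraK; letI := T.instFieldFbar; letI := T.instAlgebraFbar
    letI := T.instAlgebraKFbar; letI := T.instIsElliptic
    haveI : Fact (Nat.Prime 7) := ⟨by norm_num⟩
    ∀ x₀ : (thetaIndex (pilotDataOfK T.D T.K)).Fibre (.inr ⟨7, by norm_num⟩),
      absRamificationIdx 7 (kOf (pilotDataOfK T.D T.K) 7 x₀) ≤ 30 * l := by
  intro x₀
  exact Nat.le_of_dvd (by omega) (GenuineK.localType_lamSeven_thirty hk h11 T x₀).2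

end Summit.ABC.IUTFork.Conditional

end
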